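import Mathlib
import Summits.KontsevichZagierPeriods.Zeta5Search.Families.DualCellBZChart
import HarnessLib

/-!
# ζ(5) search — Families: the Brown–Zudilin (10)-integrand on the dual cell IS `(−1)^{Σp}·Λ_a·[06]/∏g` (P2 g7, assembly of F82)

HONEST FRAMING: systematic search; no irrationality claim unless certified.  Cell `pub-zeta5`, prover P2 (g7,
2026-08-22).  Pure algebra over an arbitrary field; nothing about the arithmetic of `ζ(5)`; no number of record moves.

`Families/DualCellBZChart` proves that each of the twelve letters `y_i, 1−y_i, D₁, D₂` of [BrownZudilin2022, (10)],
written in the dual-cell positions `w` through the three-rotation chart, is the signed chord monomial recorded in the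
data `letterNeg/letterExp` (`letterVal_eq_chordMon`), and that the data satisfy the exponent identity `chordExp_total`
and the sign identity `letterSign_total`.  Here the pieces are MULTIPLIED OUT: with integer powers (`zpow`) over the 21
chords `[jk]`, `j < k`,
  `∏_{l<12} letter_l ^ wt_l(a) · J = (−1)^{Σ_i p_i(a)} · ∏_{j<k} [jk]^{dualExp a j k}`            (`integrand_pullback`)
for EVERY `a ∈ ℤ⁸` and every injective `w`, where `wt(a) = (p₁,p₂,p₃+1,p₄,p₅; q₁..q₅; −p₀−1, −p₆−1)` are the exponents
of the letters in the integrand of (10) at `(p;q) = (pOf a; qOf a)`, `J = −[26]²/([01][12][23]²[24][45][56])` is the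
Jacobian monomial `∂(y)/∂(w₁..w₅)` (taken here as this monomial — its derivation is a symbolic computation outside the
kernel, re-derived by both referees), and `dualExp a` = (`bzNum a` on the six finite `τ`-chords, `−bzDen a − 1` on the
six gaps, `1` on `[06]`) — i.e. the right-hand side is `(−1)^{Σp}·Λ_a·[06]/(g₀⋯g₅)`, the dual-cell integrand of
`Families/DualConstantTerm` times the gauge form.  This is step (S2) of the torus-homology proof of CONJECTURE D-exact
(`HOME/pub-zeta5-p2/g7/DEXACT-PROOF.md`) as ONE kernel identity; (S3)–(S5) remain on paper and the conjecture node
stays `@[conjecture]`.  Standard axioms only.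
-/

namespace Summit.KontsevichZagierPeriods.Zeta5Search.Families.Cellular
namespace BZChart

open Finset
open Literature.NumberTheory.Irrationality.BrownZudilin2022 (pOf qOf)

variable {K : Type*} [Field K]

/-- The chords of `n` points: ordered pairs `j < k` in `Fin n`. -/
def pairsN (n : ℕ) : Finset (Fin n × Fin n) := Finset.univ.filter fun p => p.1 < p.2

/-- The 21 chords of seven points. -/
abbrev pairs7 : Finset (Fin 7 × Fin 7) := pairsN 7

/-- Signed chord monomial over the chords of `n` points with an integer sign exponent: `(−1)^s · ∏_{j<k} [jk]^{e j k}`. -/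
def cmon {n : ℕ} (w : Fin n → K) (s : ℤ) (e : Fin n → Fin n → ℤ) : K :=
  (-1 : K) ^ s * ∏ p ∈ pairsN n, (w p.2 - w p.1) ^ e p.1 p.2

section algebra

variable {ι : Type*} {n : ℕ} {w : Fin n → K}

/-- `(∏ f)^n = ∏ f^n` for integer powers in a field. -/
theorem prod_zpow' (s : Finset ι) (f : ι → K) (n : ℤ) : (∏ i ∈ s, f i) ^ n = ∏ i ∈ s, f i ^ n := by
  classical
  induction s using Finset.induction_on with
  | empty => simp
  | insert a s ha ih => rw [prod_insert ha, prod_insert ha, mul_zpow, ih]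

/-- `∏ c^{f i} = c^{Σ f i}` for `c ≠ 0`. -/
theorem prod_zpow_eq_zpow_sum (s : Finset ι) {c : K} (hc : c ≠ 0) (f : ι → ℤ) :
    ∏ i ∈ s, c ^ f i = c ^ ∑ i ∈ s, f i := by
  classical
  induction s using Finset.induction_on with
  | empty => simp
  | insert a s ha ih => rw [prod_insert ha, sum_insert ha, zpow_add₀ hc, ih]

/-- Chords `[jk]`, `j < k`, are non-zero for injective `w`. -/
private theorem chord_ne (hw : Function.Injective w) (p : Fin n × Fin n) (hp : p ∈ pairsN n) : w p.2 - w p.1 ≠ 0 := by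
  have h : p.1 < p.2 := (Finset.mem_filter.mp hp).2
  exact sub_ne_zero.mpr (hw.ne (ne_of_gt h))

/-- Integer power of a signed chord monomial. -/
theorem cmon_zpow (s : ℤ) (e : Fin n → Fin n → ℤ) (m : ℤ) :
    cmon w s e ^ m = cmon w (s * m) (fun j k => e j k * m) := by
  unfold cmon
  rw [mul_zpow, zpow_mul, prod_zpow']
  congr 1
  refine prod_congr rfl fun p _ => ?_
  rw [zpow_mul]

/-- Product of two signed chord monomials. -/
theorem cmon_mul (hw : Function.Injective w) (s s' : ℤ) (e e' : Fin n → Fin n → ℤ) :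
    cmon w s e * cmon w s' e' = cmon w (s + s') (fun j k => e j k + e' j k) := by
  unfold cmon
  have h1 : (-1 : K) ≠ 0 := neg_ne_zero.mpr one_ne_zero
  rw [zpow_add₀ h1]
  rw [show ((-1 : K) ^ s * ∏ p ∈ pairsN n, (w p.2 - w p.1) ^ e p.1 p.2) *
        ((-1 : K) ^ s' * ∏ p ∈ pairsN n, (w p.2 - w p.1) ^ e' p.1 p.2) =
      ((-1 : K) ^ s * (-1 : K) ^ s') *
        ((∏ p ∈ pairsN n, (w p.2 - w p.1) ^ e p.1 p.2) * ∏ p ∈ pairsN n, (w p.2 - w p.1) ^ e' p.1 p.2) by ring]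
  congr 1
  rw [← prod_mul_distrib]
  refine prod_congr rfl fun p hp => ?_
  rw [← zpow_add₀ (chord_ne hw p hp)]

/-- A finite product of integer powers of signed chord monomials is the signed chord monomial of the summed data. -/
theorem prod_cmon_zpow (hw : Function.Injective w) {m : ℕ} (s : Fin m → ℤ) (e : Fin m → Fin n → Fin n → ℤ)
    (c : Fin m → ℤ) (t : Finset (Fin m)) :
    ∏ l ∈ t, cmon w (s l) (e l) ^ c l = cmon w (∑ l ∈ t, s l * c l) (fun j k => ∑ l ∈ t, e l j k * c l) := by
  classical
  induction t using Finset.induction_on with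
  | empty => simp [cmon]
  | insert a t ha ih =>
    rw [prod_insert ha, ih, cmon_zpow, cmon_mul hw, sum_insert ha]
    congr 1
    funext j k
    rw [sum_insert ha]

end algebra

section letters

variable {w : Fin 7 → K}

/-- The Jacobian `∂(y₁..y₅)/∂(w₁..w₅)` of the chart, AS A CHORD MONOMIAL (exponent row 12 of `letterExp`, sign `−`):
`−[26]²/([01][12][23]²[24][45][56])`.  (Its identification with the actual Jacobian determinant is a symbolic computation
outside the kernel.) -/
def jacMon (w : Fin 7 → K) : K := cmon w 1 (letterExp 12)

/-- The product over the 21 chords, written out. -/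
theorem prod_pairs7 (f : Fin 7 × Fin 7 → K) : ∏ p ∈ pairsN 7, f p =
    f (0,1) * f (0,2) * f (0,3) * f (0,4) * f (0,5) * f (0,6) * f (1,2) * f (1,3) * f (1,4) * f (1,5) * f (1,6) *
      f (2,3) * f (2,4) * f (2,5) * f (2,6) * f (3,4) * f (3,5) * f (3,6) * f (4,5) * f (4,6) * f (5,6) := by
  rw [pairsN, Finset.prod_filter, ← Finset.univ_product_univ, Finset.prod_product]
  simp (config := { decide := true }) only [Fin.prod_univ_seven, ite_true, ite_false, mul_one, one_mul,
    Fin.isValue]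
  ring

/-- Each letter is the signed chord monomial of the data, in the 21-chord product form. -/
theorem letterVal_eq_cmon (hw : Function.Injective w) (l : Fin 12) :
    letterVal w l = cmon w (if letterNeg (Fin.castSucc l) then 1 else 0) (letterExp (Fin.castSucc l)) := by
  have hsne : ∀ {i j : Fin 7}, i ≠ j → w i - w j ≠ 0 := fun h => sub_ne_zero.mpr (hw.ne h)
  fin_cases l <;>
    simp [letterVal, cmon, prod_pairs7, letterNeg, letterExp, yOf_eq hw, zpow_neg, zpow_ofNat] <;>
    field_simp (disch := first | assumption | exact hsne (by decide)) <;> ring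

/-- The integer sign exponent of letter `l`: `1` for the negative letters, `0` otherwise. -/
def sgnExp (l : Fin 13) : ℤ := if letterNeg l then 1 else 0

/-- **The assembled pull-back identity.**  For every `a ∈ ℤ⁸` and injective `w`:
`∏_{l<12} letter_l ^ wt_l(a) · J = (−1)^{Σ_i p_i(a)} · ∏_{j<k} [jk]^{dualExp a j k}` — the integrand of (10) at
`(pOf a; qOf a)`, transported to the dual cell, is `(−1)^{Σp}·Λ_a·[06]/(g₀⋯g₅)` at the level of rational functions. -/
theorem integrand_pullback (hw : Function.Injective w) (a : Fin 8 → ℤ) :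
    (∏ l : Fin 12, letterVal w l ^ letterWt a (Fin.castSucc l)) * jacMon w =
      cmon w (∑ i, pOf a i) (dualExp a) := by
  -- rewrite every letter as its signed chord monomial and multiply out
  have hL : ∀ l : Fin 12, letterVal w l ^ letterWt a (Fin.castSucc l) =
      cmon w (sgnExp (Fin.castSucc l)) (letterExp (Fin.castSucc l)) ^ letterWt a (Fin.castSucc l) := by
    intro l; rw [letterVal_eq_cmon hw l]; rfl
  rw [Finset.prod_congr rfl fun l _ => hL l, prod_cmon_zpow hw, jacMon,
    show cmon w 1 (letterExp 12) = cmon w 1 (letterExp 12) ^ (1 : ℤ) by rw [zpow_one], cmon_zpow, cmon_mul hw]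
  -- exponents: `chordExp_total`; sign: `letterSign_total` and the parity of `Σp − 2p₀ − 2p₆`
  have hE : (fun j k => (∑ l : Fin 12, letterExp (Fin.castSucc l) j k * letterWt a (Fin.castSucc l)) +
      letterExp 12 j k * 1) = dualExp a := by
    funext j k
    have h := chordExp_total a j k
    rw [Fin.sum_univ_castSucc] at h
    simp only [Fin.last] at h
    have h12 : ((12 : Fin 13)) = ⟨12, by norm_num⟩ := rfl
    rw [← h]
    simp only [mul_comm (letterWt a _) _, mul_one]
    simp [letterWt]
  have hS : (∑ l : Fin 12, sgnExp (Fin.castSucc l) * letterWt a (Fin.castSucc l)) + 1 * 1 =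
      (∑ i, pOf a i) - 2 * pOf a 0 - 2 * pOf a 6 := by
    have h := letterSign_total a
    rw [Fin.sum_univ_castSucc] at h
    simp only [sgnExp]
    simp [Fin.sum_univ_succ, letterNeg, letterWt] at h ⊢
    linarith
  rw [hE, hS]
  unfold cmon
  congr 1
  have h1 : (-1 : K) ≠ 0 := neg_ne_zero.mpr one_ne_zero
  rw [show (∑ i, pOf a i) - 2 * pOf a 0 - 2 * pOf a 6 = (∑ i, pOf a i) + 2 * (-(pOf a 0) - pOf a 6) by ring,
    zpow_add₀ h1, zpow_mul]
  norm_num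

end letters

end BZChart
end Summit.KontsevichZagierPeriods.Zeta5Search.Families.Cellular
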